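import Summits.CriticalPhenomena.PercolationContinuityZ3.Theorems.PercNearOneGluingNoHeavyLowerTailSunflowerMultiPetalSpectator
import Summits.CriticalPhenomena.PercolationContinuityZ3.Theorems.PercNearOneGluingNoHeavyLowerTailSunflowerRestrictionSeriesPair
import Summits.CriticalPhenomena.PercolationContinuityZ3.Theorems.PercNearOneGluingNoHeavyLowerTailSunflowerSpectatorTransferOrPetalPair
import HarnessLib
import HarnessLib.Audit

/-!
# `NoHeavyLowerTail` (crux stmt-CriticalPhenomena-4575), abstract sunflower cubic, `k` petals: the multi-petal partition lemma ★ₖ — and even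
# LEMMA B — for sunflowers with ISOLATED petal sets (antichain middle zone), by a POINTWISE one-coordinate induction over a chain of section types

Support file (seat `prim-l12-p2` gen 26; `--supports stmt-CriticalPhenomena-4575`; companion of `…SunflowerMultiPetal` (`MSunflower`, `s6K`, `ZK`,
`PartitionLemmaK`), `…SunflowerMultiPetalSpectator`, `…SunflowerRestrictionSeriesPair` (`nested`, `nested_swap12/23`, `nested_insert_split`), `…SunflowerSpectatorTransferOrPetalPair` (`sum_parts_eq_nested_univ`)).  No `sorry`; nothing about the crux.
Memo: run/shared/lean/prim/prim-l12/prim-l12-p2/FINDING-g26-MULTIPETAL-COMPONENT-LEMMA.md §4.7.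

SETTING (the CHAIN class).  `U` an up-set of `2^α`, `S` a set of MINIMAL elements of `U` (`s.erase x ∉ U` for `s ∈ S`, `x ∈ s`; only `S ∩ U` matters) with `∅ ∉ S`.  Code the cells on
the chain `0 < 1 < 2`: `clab X = 0` ("white", `X ∉ U`), `1` ("grey", `X ∈ S`), `2` ("black", `X ∈ U ∖ S`).  Kernels on `Fin 3`: `kk3` (`+1` on {2,0}, `−1` on (1,1)),
the Lemma-B kernel `lb3` (symmetrised: `+2` on the multiset {2,0,0}, `−1` on {0,1,1} and {1,1,1}) and the full kernel `s3 = Σ_cyc [x = 2]·kk3 y z + lb3`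
(`+2` on {2,0,0}, {2,2,0}; `−1` on {2,1,1}, {0,1,1}, {1,1,1}) — this is `s6K` with ALL pairs of grey blocks counted as distinct petals (two disjoint grey
sets are different minimal elements).

THEOREM (this work).  For every sub-cube `W`:  `0 ≤ AG3 W` (two-block Gladkov sum), `0 ≤ LB3 W` (**Lemma B in the chain class**) and `0 ≤ Z3 W = 3·BS3 W + LB3 W`
(`AG3_nonneg`, `LB3_nonneg`, `Z3_nonneg`).  PROOF: along a free coordinate `e` the pair `(clab X, clab (insert e X))` lies in the five-element CHAIN of section
types `(0,0),(0,1),(0,2),(1,2),(2,2)` (`secOK`; a grey or black set becomes black, `clab_secOK`), and the one-coordinate increments of `AG3` and `LB3` are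
nonnegative POINTWISE on these types (`kk3_lift`, `lb3_lift`, `decide` on `Fin 3`); induct on `W` (`nested_insert_split`).  The incomparable-petal obstruction
of the general one-coordinate step (memo ABSTRACT-SUNFLOWER-CUBIC §10.4) is absent because the types form a chain.
COROLLARY (`MSunflower.ZK_nonneg_of_isolated`): ★ₖ holds for every `MSunflower k α` all of whose petal sets are ISOLATED (every lower cover of a petal set lies
in no `V j`) and with `∅` not a petal set — for every `k` (pointwise `s6K ≥ s3 ∘ chain code`, `s6K_ge_s3`).  For `k = 3` this class lies inside prim-ineq-gen-2's
petal-completing class (`Sunflower.ZH_nonneg_of_petalCompleting`); new here are the Lemma-B form, the all-`k` statement and the chain-type proof.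
-/

namespace Summit.CriticalPhenomena.PercolationContinuityZ3.Theorems.SunflowerPartition

open Finset

variable {α : Type*} [DecidableEq α]

/-! ## The nested sum on the empty cube (`nested_insert_split` is in `…SunflowerRestrictionSeriesPair`) -/

/-- The nested sum on the empty cube. [this work] -/
theorem nested_empty (G : Finset α → Finset α → Finset α → ℤ) : nested (∅ : Finset α) G = G ∅ ∅ ∅ := by
  unfold nested
  rw [powerset_empty, sum_singleton, sdiff_self, bot_eq_empty, powerset_empty, sum_singleton, sdiff_self, bot_eq_empty]

/-! ## Kernels on the chain `0 < 1 < 2` and their pointwise lifting inequalities -/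

/-- Two-block kernel on the chain: `+1` on {black, white}, `−1` on two grey blocks. [this work] -/
def kk3 (a b : Fin 3) : ℤ := if (a = 2 ∧ b = 0) ∨ (a = 0 ∧ b = 2) then 1 else if a = 1 ∧ b = 1 then -1 else 0

/-- Lemma-B kernel (symmetrised white-spectator + rainbow part): `+2` on the multiset {2,0,0}, `−1` on {0,1,1} and {1,1,1}. [this work] -/
def lb3 (x y z : Fin 3) : ℤ :=
  (if x = 0 then kk3 y z else 0) + (if y = 0 then kk3 x z else 0) + (if z = 0 then kk3 x y else 0) - (if x = 1 ∧ y = 1 ∧ z = 1 then 1 else 0)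

/-- Full kernel of the chain class: black-spectator parts plus `lb3`. [this work] -/
def s3 (x y z : Fin 3) : ℤ :=
  (if x = 2 then kk3 y z else 0) + (if y = 2 then kk3 x z else 0) + (if z = 2 then kk3 x y else 0) + lb3 x y z

/-- Admissible section type `(lower, upper)` (Boolean test): a white set may become anything, a grey or black set becomes black. [this work] -/
def secOK (a b : Fin 3) : Bool := a == 0 || (a == 1 && b == 2) || (a == 2 && b == 2)

/-- Pointwise lifting inequality for the two-block kernel. [this work] -/
theorem kk3_lift : ∀ y0 y1 z0 z1 : Fin 3, secOK y0 y1 = true → secOK z0 z1 = true → kk3 y0 z0 ≤ kk3 y1 z0 + kk3 y0 z1 := by decide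

/-- Pointwise lifting inequality for the Lemma-B kernel (the heart of the matter: nonnegative on ALL admissible type triples). [this work] -/
theorem lb3_lift : ∀ x0 x1 y0 y1 z0 z1 : Fin 3, secOK x0 x1 = true → secOK y0 y1 = true → secOK z0 z1 = true →
    lb3 x0 y0 z0 ≤ lb3 x1 y0 z0 + lb3 x0 y1 z0 + lb3 x0 y0 z1 := by decide

/-- `kk3` on a white base pair. [this work] -/
theorem kk3_base : ∀ a : Fin 3, a ≠ 1 → 0 ≤ kk3 a a := by decide

/-- `lb3` on the diagonal off the grey value. [this work] -/
theorem lb3_base : ∀ a : Fin 3, a ≠ 1 → 0 ≤ lb3 a a a := by decide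

/-- `kk3` is symmetric. [this work] -/
theorem kk3_comm : ∀ a b : Fin 3, kk3 a b = kk3 b a := by decide

/-! ## The chain class: an up-set with designated minimal (grey) elements -/

/-- The chain code: `0` outside `U`, `1` on `S`, `2` on `U ∖ S`. [this work] -/
def clab (U S : Finset (Finset α)) (X : Finset α) : Fin 3 := if X ∈ U then (if X ∈ S then 1 else 2) else 0

section ChainClass

variable (U S : Finset (Finset α)) (hU : IsUpperSet (U : Set (Finset α)))
  (hmin : ∀ s ∈ S, ∀ x ∈ s, s.erase x ∉ U)

include hU hmin in
/-- Along a free coordinate the section type is admissible. [this work] -/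
theorem clab_secOK {X : Finset α} {e : α} (he : e ∉ X) : secOK (clab U S X) (clab U S (insert e X)) = true := by
  unfold secOK clab
  by_cases hX : X ∈ U
  · have hX' : insert e X ∈ U := hU (subset_insert e X) hX
    have hnot : insert e X ∉ S := by
      intro hs
      have := hmin _ hs e (mem_insert_self e X)
      rw [erase_insert he] at this
      exact this hX
    by_cases hXS : X ∈ S
    · simp [hX, hXS, hX', hnot]
    · simp [hX, hXS, hX', hnot]
  · simp [hX]

/-- The two-block Gladkov sum of the cube `2^W` in the chain code. [this work] -/
def AG3 (W : Finset α) : ℤ := ∑ Y ∈ W.powerset, kk3 (clab U S Y) (clab U S (W \ Y))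

/-- The Lemma-B functional of the sub-cube `W`. [this work] -/
def LB3 (W : Finset α) : ℤ := nested W fun X Y Z => lb3 (clab U S X) (clab U S Y) (clab U S Z)

/-- The black-spectator functional. [this work] -/
def BS3 (W : Finset α) : ℤ := nested W fun X Y Z => if clab U S X = 2 then kk3 (clab U S Y) (clab U S Z) else 0

/-- The full functional of the chain class. [this work] -/
def Z3 (W : Finset α) : ℤ := nested W fun X Y Z => s3 (clab U S X) (clab U S Y) (clab U S Z)

include hU hmin in
/-- **Two-block Gladkov in the chain class**, by a pointwise induction on the cube (requires `∅ ∉ S`). [this work] -/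
theorem AG3_nonneg (h0 : ∅ ∉ S) (W : Finset α) : 0 ≤ AG3 U S W := by
  induction W using Finset.induction_on with
  | empty =>
    unfold AG3
    rw [powerset_empty, sum_singleton, sdiff_self, bot_eq_empty]
    refine kk3_base _ ?_
    unfold clab; split_ifs <;> simp_all
  | insert e W' he ih =>
    unfold AG3 at ih ⊢
    rw [sum_powerset_insert he]
    have h2 : ∑ Y ∈ W'.powerset, kk3 (clab U S (insert e Y)) (clab U S (insert e W' \ insert e Y))
        = ∑ Y ∈ W'.powerset, kk3 (clab U S (insert e Y)) (clab U S (W' \ Y)) := by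
      refine sum_congr rfl fun Y _ => ?_
      rw [Sunflower.insert_sdiff_insert_of_not_mem he]
    have h1 : ∑ Y ∈ W'.powerset, kk3 (clab U S Y) (clab U S (insert e W' \ Y))
        = ∑ Y ∈ W'.powerset, kk3 (clab U S Y) (clab U S (insert e (W' \ Y))) := by
      refine sum_congr rfl fun Y hY => ?_
      have heY : e ∉ Y := fun h => he (mem_powerset.1 hY h)
      rw [insert_sdiff_of_notMem W' heY]
    rw [h1, h2, ← sum_add_distrib]
    refine le_trans ih (sum_le_sum fun Y hY => ?_)
    have heY : e ∉ Y := fun h => he (mem_powerset.1 hY h)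
    have heWY : e ∉ W' \ Y := fun h => he (mem_sdiff.1 h).1
    have := kk3_lift _ _ _ _ (clab_secOK U S hU hmin heY) (clab_secOK U S hU hmin heWY)
    linarith

include hU hmin in
/-- **LEMMA B IN THE CHAIN CLASS**: `0 ≤ LB3 W` for every sub-cube, by the pointwise one-coordinate step `lb3_lift` (requires `∅ ∉ S`). [this work] -/
theorem LB3_nonneg (h0 : ∅ ∉ S) (W : Finset α) : 0 ≤ LB3 U S W := by
  induction W using Finset.induction_on with
  | empty =>
    unfold LB3
    rw [nested_empty]
    refine lb3_base _ ?_
    unfold clab; split_ifs <;> simp_all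
  | insert e W' he ih =>
    unfold LB3 at ih ⊢
    rw [nested_insert_split W' e he]
    unfold nested at ih ⊢
    rw [← sum_add_distrib, ← sum_add_distrib]
    refine le_trans ih (sum_le_sum fun X hX => ?_)
    rw [← sum_add_distrib, ← sum_add_distrib]
    refine sum_le_sum fun Y hY => ?_
    have heX : e ∉ X := fun h => he (mem_powerset.1 hX h)
    have hYW : Y ⊆ W' \ X := mem_powerset.1 hY
    have heY : e ∉ Y := fun h => he ((mem_sdiff.1 (hYW h)).1)
    have heT : e ∉ (W' \ X) \ Y := fun h => he ((mem_sdiff.1 (mem_sdiff.1 h).1).1)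
    exact lb3_lift _ _ _ _ _ _ (clab_secOK U S hU hmin heX) (clab_secOK U S hU hmin heY)
      (clab_secOK U S hU hmin heT)

include hU hmin in
/-- The black-spectator functional is a sum of Gladkov sums of complement cubes, hence `≥ 0`. [this work] -/
theorem BS3_nonneg (h0 : ∅ ∉ S) (W : Finset α) : 0 ≤ BS3 U S W := by
  unfold BS3 nested
  refine sum_nonneg fun X _ => ?_
  by_cases hX : clab U S X = 2
  · simp only [hX, if_true]
    exact AG3_nonneg U S hU hmin h0 (W \ X)
  · simp [hX]

/-- **Spectator form in the chain class**: `Z3 = 3·BS3 + LB3` (block-relabelling symmetry). [this work] -/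
theorem Z3_eq (W : Finset α) : Z3 U S W = 3 * BS3 U S W + LB3 U S W := by
  unfold Z3 BS3 LB3
  have h2 : nested W (fun X Y Z => if clab U S Y = 2 then kk3 (clab U S X) (clab U S Z) else 0)
      = nested W (fun X Y Z => if clab U S X = 2 then kk3 (clab U S Y) (clab U S Z) else 0) :=
    (nested_swap12 W _).symm
  have h3 : nested W (fun X Y Z => if clab U S Z = 2 then kk3 (clab U S X) (clab U S Y) else 0)
      = nested W (fun X Y Z => if clab U S X = 2 then kk3 (clab U S Y) (clab U S Z) else 0) := by
    rw [nested_swap23 W (fun X Y Z => if clab U S Z = 2 then kk3 (clab U S X) (clab U S Y) else 0),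
      nested_swap12 W (fun X Y Z => if clab U S Y = 2 then kk3 (clab U S X) (clab U S Z) else 0)]
  have hs : nested W (fun X Y Z => s3 (clab U S X) (clab U S Y) (clab U S Z))
      = nested W (fun X Y Z => if clab U S X = 2 then kk3 (clab U S Y) (clab U S Z) else 0)
        + nested W (fun X Y Z => if clab U S Y = 2 then kk3 (clab U S X) (clab U S Z) else 0)
        + nested W (fun X Y Z => if clab U S Z = 2 then kk3 (clab U S X) (clab U S Y) else 0)
        + nested W (fun X Y Z => lb3 (clab U S X) (clab U S Y) (clab U S Z)) := by
    unfold nested s3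
    simp only [sum_add_distrib]
  rw [hs, h2, h3]
  ring

include hU hmin in
/-- **★ IN THE CHAIN CLASS**: `0 ≤ Z3 W` for every sub-cube. [this work] -/
theorem Z3_nonneg (h0 : ∅ ∉ S) (W : Finset α) : 0 ≤ Z3 U S W := by
  rw [Z3_eq]
  have h1 := BS3_nonneg U S hU hmin h0 W
  have h2 := LB3_nonneg U S hU hmin h0 W
  linarith

end ChainClass

/-! ## Bridge: `MSunflower`s with isolated petal sets -/

/-- Pointwise: the multi-petal kernel dominates the chain kernel of the chain code (top ↔ 2, bottom ↔ 0, petal ↦ 1), because the chain kernel treats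
every pair of grey blocks as distinct petals. [this work] -/
theorem s6K_ge_s3 {k : ℕ} (x y z : Fin (k + 2)) (a b c : Fin 3)
    (hxt : x = Fin.last (k + 1) ↔ a = 2) (hx0 : x = 0 ↔ a = 0)
    (hyt : y = Fin.last (k + 1) ↔ b = 2) (hy0 : y = 0 ↔ b = 0)
    (hzt : z = Fin.last (k + 1) ↔ c = 2) (hz0 : z = 0 ↔ c = 0) : s3 a b c ≤ s6K k x y z := by
  -- both kernels depend only on (top?, bottom?, pairwise equalities); reduce to the chart of `x,y,z` in `Fin 5` and decide there
  have key : ∀ (a b c : Fin 3) (p q r : Fin 5), (p = 4 ↔ a = 2) → (p = 0 ↔ a = 0) → (q = 4 ↔ b = 2) → (q = 0 ↔ b = 0) →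
      (r = 4 ↔ c = 2) → (r = 0 ↔ c = 0) → s3 a b c ≤ s6K 3 p q r := by decide
  have hxt' := (chart3_eq_four_iff k x y x); have hx0' := (chart3_eq_zero_iff k x y x)
  have hyt' := (chart3_eq_four_iff k x y y); have hy0' := (chart3_eq_zero_iff k x y y)
  have hzt' := (chart3_eq_four_iff k x y z); have hz0' := (chart3_eq_zero_iff k x y z)
  have hxy : x = y ↔ chart3 k x y x = chart3 k x y y := chart3_eq_iff k x y (fun h _ => absurd rfl h.1)
  have hyz : y = z ↔ chart3 k x y y = chart3 k x y z := chart3_eq_iff k x y (fun h _ => absurd rfl h.2)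
  have hxz : x = z ↔ chart3 k x y x = chart3 k x y z := chart3_eq_iff k x y (fun h _ => absurd rfl h.1)
  have e4 : (4 : Fin 5) = Fin.last (3 + 1) := rfl
  have E := s6K_congr (k := k) (k' := 3) (e4 ▸ hxt'.symm) hx0'.symm (e4 ▸ hyt'.symm) hy0'.symm (e4 ▸ hzt'.symm) hz0'.symm hxy hyz hxz
  rw [E]
  exact key a b c _ _ _ (hxt'.trans hxt) (hx0'.trans hx0) (hyt'.trans hyt) (hy0'.trans hy0) (hzt'.trans hzt) (hz0'.trans hz0)

namespace MSunflower

variable [Fintype α] {k : ℕ} (F : MSunflower k α)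

/-- **★ₖ FOR ISOLATED PETALS** (this work): if every petal set of `F` is isolated from below (each lower cover lies in no `V j`) and `∅` is not a petal set,
then `0 ≤ F.ZK` — for every number `k` of petals. [this work] -/
theorem ZK_nonneg_of_isolated
    (hiso : ∀ i (T : Finset α), T ∈ F.V i → T ∉ F.A → ∀ x ∈ T, ∀ j, T.erase x ∉ F.V j)
    (h0 : ∀ i, (∅ : Finset α) ∈ F.V i → (∅ : Finset α) ∈ F.A) : 0 ≤ F.ZK := by
  classical
  -- the chain data
  set U : Finset (Finset α) := univ.filter fun X => X ∈ F.A ∨ ∃ i, X ∈ F.V i with hUdef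
  set S : Finset (Finset α) := univ.filter fun X => X ∉ F.A ∧ ∃ i, X ∈ F.V i with hSdef
  have hU : IsUpperSet (U : Set (Finset α)) := by
    intro X Y hXY hX
    simp only [hUdef, coe_filter, mem_univ, true_and, Set.mem_setOf_eq] at hX ⊢
    rcases hX with hA | ⟨i, hi⟩
    · exact Or.inl (F.upperA hXY hA)
    · exact Or.inr ⟨i, F.upperV i hXY hi⟩
  have hmin : ∀ s ∈ S, ∀ x ∈ s, s.erase x ∉ U := by
    intro s hs x hx hU'
    simp only [hSdef, hUdef, mem_filter, mem_univ, true_and] at hs hU'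
    obtain ⟨hsA, i, hsi⟩ := hs
    rcases hU' with hj | ⟨j, hj⟩
    · exact hsA (F.upperA (erase_subset x s) hj)
    · exact hiso i s hsi hsA x hx j hj
  have hS0 : (∅ : Finset α) ∉ S := by
    intro h
    simp only [hSdef, mem_filter, mem_univ, true_and] at h
    obtain ⟨hA, i, hi⟩ := h
    exact hA (h0 i hi)
  -- labels versus chain code
  have code : ∀ X : Finset α,
      (F.lab X = Fin.last (k + 1) ↔ clab U S X = 2) ∧ (F.lab X = 0 ↔ clab U S X = 0) := by
    intro X
    rcases F.lab_cases X with hA | hz | ⟨i, hA, hi, hlab⟩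
    · have hXU : X ∈ U := by
        simp only [hUdef, mem_filter, mem_univ, true_and]
        exact Or.inl hA
      have hXS : X ∉ S := by simp only [hSdef, mem_filter, mem_univ, true_and, not_and]; exact fun h => absurd hA h
      refine ⟨⟨fun _ => by simp [clab, hXU, hXS], fun _ => (F.lab_eq_last_iff X).2 hA⟩, ⟨fun h => ?_, fun h => ?_⟩⟩
      · exact absurd ((F.lab_eq_last_iff X).2 hA) (by rw [h]; intro hh; have := congrArg Fin.val hh; simp at this)
      · simp [clab, hXU, hXS] at h
    · have hX := (F.lab_eq_zero_iff X).1 hz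
      have hXU : X ∉ U := by
        simp only [hUdef, mem_filter, mem_univ, true_and, not_or, not_exists]
        exact ⟨hX.1, fun i => hX.2 i⟩
      refine ⟨⟨fun h => ?_, fun h => ?_⟩, ⟨fun _ => by simp [clab, hXU], fun _ => hz⟩⟩
      · rw [hz] at h; have := congrArg Fin.val h; simp at this
      · simp [clab, hXU] at h
    · have hXU : X ∈ U := by simp only [hUdef, mem_filter, mem_univ, true_and]; exact Or.inr ⟨i, hi⟩
      have hXS : X ∈ S := by simp only [hSdef, mem_filter, mem_univ, true_and]; exact ⟨hA, i, hi⟩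
      refine ⟨⟨fun h => absurd (h ▸ hlab ▸ rfl : petalLab k i = Fin.last (k + 1)) (petalLab_ne_last k i), fun h => ?_⟩,
        ⟨fun h => absurd (hlab.symm.trans h) (petalLab_ne_zero k i), fun h => ?_⟩⟩
      · simp [clab, hXU, hXS] at h
      · simp [clab, hXU, hXS] at h
  -- compare the two functionals on the full cube
  have hle : Z3 U S univ ≤ F.ZK := by
    unfold ZK
    rw [sum_parts_eq_nested_univ (g := fun X Y Z => s6K k (F.lab X) (F.lab Y) (F.lab Z))]
    unfold Z3 nested
    refine sum_le_sum fun X _ => sum_le_sum fun Y _ => ?_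
    exact s6K_ge_s3 _ _ _ _ _ _ (code X).1 (code X).2 (code Y).1 (code Y).2 (code _).1 (code _).2
  exact le_trans (Z3_nonneg U S hU hmin hS0 univ) hle

end MSunflower

end Summit.CriticalPhenomena.PercolationContinuityZ3.Theorems.SunflowerPartition
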